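import Literature.NumberTheory.DiophantineGeometry.FunctionFieldResidueTrace
import Literature.NumberTheory.DiophantineGeometry.FunctionFieldRayClasses
import Literature.NumberTheory.DiophantineGeometry.FunctionFieldGenusApproximationProofs
import Mathlib.Algebra.Group.AddChar
import HarnessLib

/-!
# The trace-of-residues homomorphism `D ↦ Σ_v D(v) · Tr_{F_v/K}(f mod v)` of a function `f` regular
outside one place, its reciprocity law modulo `(m+1)·Q`, and its nontriviality
(the ramified character `ψ ∘ f` of [KohelShparlinski2000, Thm. 1]; Tate 1968 §2 (R4), residue theorem)

Topic: `Literature/NumberTheory/DiophantineGeometry` (places `AlgFunctionField.PlaceOver`, divisors, Tate's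
local residues `PlaceOver.localRes` and the residue theorem `sum_localRes_eq_zero` of
`FunctionFieldResidues`, the trace formula `localRes_mul_inv_eq_ord_mul_trace` of
`FunctionFieldResidueTrace`, rays `PlaceOver.ray` of `FunctionFieldRayClasses`). Let `F/K` be an
algebraic function field with full constant field `K`, `Q` a place and `f ∈ F`.

* `traceResidue Q f v = Tr_{F_v/K}(f mod v)` for a place `v ≠ Q` at which `f` is integral (and `0`
  otherwise); `traceDivisorHom Q f : Div(F) →+ K`, `D ↦ Σ_v D(v) · traceResidue Q f v`.
* **The residue formula** `traceDivisorHom_principalDivisor` (Tate (R4) with the residue theorem): if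
  `f` is regular outside `Q`, then for every `h ≠ 0`
  `Σ_v v(h) · Tr_{F_v/K}(f mod v) = -res_Q(f h⁻¹ dh)`.
* **Reciprocity modulo `(m+1)·Q`** (`traceDivisorHom_principalDivisor_eq_zero_of_mem_ray`): if moreover
  `v_Q(f) ≥ -m` and `h ≡ 1 (mod 𝔪_Q^{m+1})`, then `Σ_v v(h) · Tr(f mod v) = 0` (local expansion at `Q`,
  Tate's Thm. 2 in the form `localRes_eq_zero_of_expansion`). Hence for every character `ψ` of `K`
  the character **`traceResidueChar ψ Q f = ψ ∘ traceDivisorHom Q f`** of `Div(F)` is a ray class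
  character modulo `(m+1)·Q` (`traceResidueChar_principalDivisor_of_mem_ray`); at a rational place
  `v ≠ Q` its value on `v` is `ψ(f(v))` (`traceResidue_eq_of_sub_algebraMap_mem`). This is the
  character "`ψ ∘ f`, of conductor `(n_Q + 1)·Q` when `(n_Q, q) = 1`" of
  [KohelShparlinski2000, Thm. 1] for a function `f` with a single pole `Q`.
* **Nontriviality** (`exists_traceDivisorHom_principalDivisor_eq`): if `Q` is rational,
  `v_Q(f) = -m` exactly, `s ∈ F` is a uniformizer at `Q` (`v_Q(s) = 1`) and `m ≠ 0` in `K`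
  (`p ∤ m`), then for every `a ∈ K` there is `h = 1 + c s^m` (`c ∈ K`), a unit at `Q`, with
  `Σ_v v(h) · Tr(f mod v) = a`: for `res_Q(f h⁻¹ d(c s^m)) = c m · (f s^m h⁻¹)(Q)` and
  `(f s^m)(Q) ≠ 0`. So `traceResidueChar ψ Q f` is nontrivial on a principal divisor prime to `Q`
  as soon as `ψ ≠ 1` (`exists_traceResidueChar_principalDivisor_ne_one`) — while it is trivial on
  the ray modulo `(m+1)·Q`; this is the input "`χ` nontrivial on a divisor of degree `0` prime to `Q`"
  of the tree's `AddChar.exists_polynomial_eq_rayClassLSeries`, and `p ∤ m` is exactly the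
  characteristic guard `p ≠ 2` (`f = x`, `m = 2`), `p ≠ 3` (`f = y`, `m = 3`) of
  `KohelShparlinski.CoordinateCharSumBound`.

Everything is proved; the definitions (`traceResidue`, `traceDivisorHom`, `traceResidueChar`) are
genuine; no named facts.

## References

* D. R. Kohel, I. E. Shparlinski, *On exponential sums and group generators for elliptic curves over
  finite fields*, ANTS-IV, LNCS 1838 (2000), Thm. 1 (p. 398: the character `ψ ∘ f` and its conductor).
  [KohelShparlinski2000]
* J. Tate, *Residues of differentials on curves*, Ann. Sci. ÉNS (4) 1 (1968), §2 (R4), §3 Thm. 2 and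
  Corollary to Thm. 3 (residue theorem). [Tate1968]
* H. Stichtenoth, *Algebraic Function Fields and Codes*, 2nd ed., GTM 254, Cor. 4.3.3, Prop. 3.7.8.
  [Stichtenoth2009]
-/

noncomputable section

open scoped Classical

namespace Literature.NumberTheory.DiophantineGeometry.AlgFunctionField

universe u v

variable {K : Type u} {F : Type v} [Field K] [Field F] [Algebra K F]

namespace PlaceOver

/-! ### The trace of the residue and the trace-of-residues homomorphism -/

/-- **`Tr_{F_v/K}(f mod v)`** for a place `v ≠ Q` at which `f` is integral; `0` at `Q` and at the poles
of `f`. [cite: KohelShparlinski2000, Thm. 1 (the character ψ ∘ f)] -/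
def traceResidue (Q : PlaceOver K F) (f : F) (v : PlaceOver K F) : K :=
  if h : v ≠ Q ∧ f ∈ v.toValuationSubring then
    Algebra.trace K v.residueField (IsLocalRing.residue v.toValuationSubring ⟨f, h.2⟩) else 0

/-- Unfolding of `traceResidue` off `Q` at a place where `f` is integral. [folklore] -/
theorem traceResidue_of_mem {Q v : PlaceOver K F} (hv : v ≠ Q) {f : F} (hf : f ∈ v.toValuationSubring) :
    traceResidue Q f v =
      Algebra.trace K v.residueField (IsLocalRing.residue v.toValuationSubring ⟨f, hf⟩) := by
  rw [traceResidue, dif_pos ⟨hv, hf⟩]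

/-- `traceResidue Q f Q = 0`. [folklore] -/
@[simp]
theorem traceResidue_self (Q : PlaceOver K F) (f : F) : traceResidue Q f Q = 0 := by
  rw [traceResidue, dif_neg (fun h => h.1 rfl)]

/-- **At a rational place the trace of the residue is the value**: if `f ≡ c (mod 𝔪_v)` with `c ∈ K`
and `deg v = 1`, then `traceResidue Q f v = c`. [cite: Stichtenoth2009, Def. 1.1.15] -/
theorem traceResidue_eq_of_sub_algebraMap_mem {Q v : PlaceOver K F} (hv : v ≠ Q) (hv1 : v.IsRational)
    {f : F} (hf : f ∈ v.toValuationSubring) {c : K}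
    (hc : v.valuation (f - algebraMap K F c) < 1) : traceResidue Q f v = c := by
  rw [traceResidue_of_mem hv hf]
  have hres : IsLocalRing.residue v.toValuationSubring ⟨f, hf⟩ = algebraMap K v.residueField c := by
    rw [PlaceOver.algebraMap_residueField_apply, ← sub_eq_zero, ← map_sub,
      IsLocalRing.residue_eq_zero_iff, ValuationSubring.valuation_lt_one_iff]
    exact hc
  rw [hres, Algebra.trace_algebraMap]
  rw [PlaceOver.IsRational, PlaceOver.degree] at hv1
  rw [hv1, one_smul]

/-- **The trace-of-residues homomorphism** `Div(F) →+ K`, `D ↦ Σ_v D(v) · Tr_{F_v/K}(f mod v)` (places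
`v ≠ Q` with `f ∈ 𝒪_v`). [cite: KohelShparlinski2000, Thm. 1 (the character ψ ∘ f)] -/
def traceDivisorHom (Q : PlaceOver K F) (f : F) : Divisor K F →+ K :=
  Finsupp.liftAddHom fun v => (AddMonoidHom.mulRight (traceResidue Q f v)).comp (Int.castAddHom K)

/-- `traceDivisorHom` on a single place. [folklore] -/
@[simp]
theorem traceDivisorHom_single (Q : PlaceOver K F) (f : F) (v : PlaceOver K F) (n : ℤ) :
    traceDivisorHom Q f (Finsupp.single v n) = n * traceResidue Q f v := by
  rw [traceDivisorHom, Finsupp.liftAddHom_apply_single]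
  rfl

/-- `traceDivisorHom` as a sum over any finite set containing the support. [folklore] -/
theorem traceDivisorHom_eq_sum (Q : PlaceOver K F) (f : F) (D : Divisor K F)
    {S : Finset (PlaceOver K F)} (hS : D.support ⊆ S) :
    traceDivisorHom Q f D = ∑ v ∈ S, (D v : K) * traceResidue Q f v := by
  rw [traceDivisorHom, Finsupp.liftAddHom_apply, Finsupp.sum_of_support_subset D hS]
  · rfl
  · intro v _
    simp

/-- `traceDivisorHom` vanishes on multiples of `Q`. [folklore] -/
@[simp]
theorem traceDivisorHom_single_self (Q : PlaceOver K F) (f : F) (n : ℤ) :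
    traceDivisorHom Q f (Finsupp.single Q n) = 0 := by
  rw [traceDivisorHom_single, traceResidue_self, mul_zero]

/-! ### The residue formula and reciprocity modulo `(m+1)·Q` -/

variable [IsAlgFunctionField K F]

/-- **The residue formula** (Tate (R4) `res_v(f h⁻¹ dh) = v(h) · Tr_{F_v/K}(f mod v)` at every `v ≠ Q`,
and the residue theorem `Σ_v res_v = 0`): if `f` is regular outside `Q`, then for `h ≠ 0`
`Σ_v v(h) · Tr_{F_v/K}(f mod v) = -res_Q(f h⁻¹ dh)`. [cite: Tate1968, §2 (R4) and Cor. to Thm. 3] -/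
theorem traceDivisorHom_principalDivisor [IsIntegrallyClosedIn K F] (Q : PlaceOver K F) {f : F}
    (hf : ∀ v : PlaceOver K F, v ≠ Q → f ∈ v.toValuationSubring) {h : F} (hh : h ≠ 0) :
    traceDivisorHom Q f (principalDivisor K h) = -(Q.localRes K (f * h⁻¹) h) := by
  have hfin := finite_setOf_ord_ne_zero_holds (K := K) hh
  set S : Finset (PlaceOver K F) := hfin.toFinset ∪ {Q} with hS
  have hQS : Q ∈ S := Finset.mem_union_right _ (Finset.mem_singleton_self Q)
  have hsupp : (principalDivisor K h).support ⊆ S := by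
    intro v hv
    rw [Finsupp.mem_support_iff, principalDivisor_apply hfin] at hv
    exact Finset.mem_union_left _ (hfin.mem_toFinset.mpr hv)
  -- off `S`, `h` is a unit and `f` is integral
  have hout : ∀ v ∉ S, f * h⁻¹ ∈ v.toValuationSubring ∧ h ∈ v.toValuationSubring := by
    intro v hv
    have hvQ : v ≠ Q := fun e => hv (e ▸ hQS)
    have hord : v.ord h = 0 := by
      by_contra hne
      exact hv (Finset.mem_union_left _ (hfin.mem_toFinset.mpr hne))
    have hhO : h ∈ v.toValuationSubring := (v.mem_toValuationSubring_iff_ord_nonneg hh).2 hord.ge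
    have hhinv : h⁻¹ ∈ v.toValuationSubring := by
      rw [v.mem_toValuationSubring_iff_ord_nonneg (inv_ne_zero hh), v.ord_inv hh, hord, neg_zero]
    exact ⟨mul_mem (hf v hvQ) hhinv, hhO⟩
  -- the residue theorem
  have hsum := sum_localRes_eq_zero (K := K) (x := f * h⁻¹) (y := h) S hout
  rw [← Finset.insert_erase hQS, Finset.sum_insert (Finset.notMem_erase Q S)] at hsum
  -- the trace formula at the places `v ≠ Q`
  rw [traceDivisorHom_eq_sum Q f _ hsupp, ← Finset.insert_erase hQS,
    Finset.sum_insert (Finset.notMem_erase Q S), traceResidue_self, mul_zero, zero_add]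
  have hterm : ∀ v ∈ S.erase Q, ((principalDivisor K h) v : K) * traceResidue Q f v =
      v.localRes K (f * h⁻¹) h := by
    intro v hv
    have hvQ : v ≠ Q := Finset.ne_of_mem_erase hv
    rw [principalDivisor_apply hfin, traceResidue_of_mem hvQ (hf v hvQ),
      v.localRes_mul_inv_eq_ord_mul_trace (hf v hvQ) hh]
  rw [Finset.sum_congr rfl hterm]
  linear_combination hsum

/-- **Vanishing of the residue at `Q` for ray functions** (Tate's Thm. 2 through the local expansion
`h - 1 = π^{m+1} u`): if `v_Q(f) ≥ -m` (i.e. `f ∈ 𝔪_Q^{-m}`) and `h ≡ 1 (mod 𝔪_Q^{m+1})`, then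
`res_Q(f h⁻¹ dh) = 0`. [cite: Tate1968, §3 Thm. 2] -/
theorem localRes_mul_inv_eq_zero_of_mem_ray (Q : PlaceOver K F) {f : F} {m : ℕ}
    (hfm : f ∈ Q.ball (-(m : ℤ))) {h : F} (hray : h ∈ Q.ray (m + 1)) :
    Q.localRes K (f * h⁻¹) h = 0 := by
  set g : F := h - 1 with hg
  have hgball : g ∈ Q.ball ((m : ℤ) + 1) := by
    have := (Q.mem_ray_iff_sub_one_mem_ball (m + 1) h).1 hray
    exact_mod_cast this
  have hh1 : Q.valuation h = 1 := valuation_eq_one_of_mem_ray (by omega) hray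
  have hh0 : h ≠ 0 := by
    intro h0; rw [h0, Valuation.map_zero] at hh1; exact zero_ne_one hh1
  -- `res(f h⁻¹ dh) = res(f h⁻¹ dg)`
  have hdec : h = g + 1 := by rw [hg]; ring
  have hres : Q.localRes K (f * h⁻¹) h = Q.localRes K (f * h⁻¹) g := by
    rw [congrArg (Q.localRes K (f * h⁻¹)) hdec, Q.localRes_add_right, Q.localRes_one_right, add_zero]
  rw [hres]
  -- the expansion `g = 0 + π^{m+1} u`
  set π : F := (Q.uniformizer : F) with hπ
  have hπ0 : π ≠ 0 := Q.coe_uniformizer_ne_zero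
  set u : F := g * π ^ (-((m : ℤ) + 1)) with hu
  have huO : u ∈ Q.toValuationSubring := Q.mul_uniformizer_zpow_neg_mem _ hgball
  have hgexp : g = algebraMap K F 0 + π ^ ((m : ℤ) + 1) * u := by
    rw [map_zero, zero_add, hu, mul_comm, mul_assoc, ← zpow_add₀ hπ0, neg_add_cancel, zpow_zero,
      mul_one]
  refine Q.localRes_eq_zero_of_expansion hgexp huO ?_
  -- `f h⁻¹ ∈ 𝔪^{1 - (m+1)} = 𝔪^{-m}`
  have hfh : f * h⁻¹ ∈ Q.ball (-(m : ℤ)) := by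
    rw [mem_ball_iff] at hfm ⊢
    rw [Valuation.map_mul, map_inv₀, hh1, inv_one, mul_one]
    exact hfm
  have : (1 : ℤ) - ((m : ℤ) + 1) = -(m : ℤ) := by ring
  rw [this]
  exact hfh

/-- **Reciprocity modulo `(m+1)·Q` for the trace-of-residues homomorphism**: if `f` is regular outside
`Q` with `v_Q(f) ≥ -m` and `h ≡ 1 (mod 𝔪_Q^{m+1})`, `h ≠ 0`, then `Σ_v v(h) · Tr_{F_v/K}(f mod v) = 0`.
This is the statement that `ψ ∘ f` has conductor dividing `(m+1)·Q` in [KohelShparlinski2000, Thm. 1]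
(`m_i ≤ n_i + 1`). [cite: KohelShparlinski2000, Thm. 1] [cite: Tate1968, §3 Thm. 2 and Cor. to Thm. 3] -/
theorem traceDivisorHom_principalDivisor_eq_zero_of_mem_ray [IsIntegrallyClosedIn K F]
    (Q : PlaceOver K F) {f : F} (hf : ∀ v : PlaceOver K F, v ≠ Q → f ∈ v.toValuationSubring)
    {m : ℕ} (hfm : f ∈ Q.ball (-(m : ℤ))) {h : F} (hray : h ∈ Q.ray (m + 1)) (hh : h ≠ 0) :
    traceDivisorHom Q f (principalDivisor K h) = 0 := by
  rw [traceDivisorHom_principalDivisor Q hf hh, Q.localRes_mul_inv_eq_zero_of_mem_ray hfm hray, neg_zero]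

/-! ### The character `ψ ∘ traceDivisorHom` -/

section Char

variable {M : Type*} [CommMonoid M]

omit [IsAlgFunctionField K F] in
/-- **The ramified character `ψ ∘ f` of the divisor group** ([KohelShparlinski2000, Thm. 1]):
`D ↦ ψ(Σ_v D(v) · Tr_{F_v/K}(f mod v))` for a character `ψ` of the additive group of `K`.
[cite: KohelShparlinski2000, Thm. 1 (the character ψ ∘ f)] -/
def traceResidueChar (ψ : AddChar K M) (Q : PlaceOver K F) (f : F) : AddChar (Divisor K F) M :=
  ψ.compAddMonoidHom (traceDivisorHom Q f)

omit [IsAlgFunctionField K F] in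
/-- Unfolding of `traceResidueChar`. [folklore] -/
@[simp]
theorem traceResidueChar_apply (ψ : AddChar K M) (Q : PlaceOver K F) (f : F) (D : Divisor K F) :
    traceResidueChar ψ Q f D = ψ (traceDivisorHom Q f D) :=
  rfl

omit [IsAlgFunctionField K F] in
/-- The value on a single place: `ψ(n · Tr(f mod v))`. [folklore] -/
theorem traceResidueChar_single (ψ : AddChar K M) (Q : PlaceOver K F) (f : F) (v : PlaceOver K F)
    (n : ℤ) : traceResidueChar ψ Q f (Finsupp.single v n) = ψ (n * traceResidue Q f v) := by
  rw [traceResidueChar_apply, traceDivisorHom_single]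

omit [IsAlgFunctionField K F] in
/-- **The value at a rational place**: `traceResidueChar ψ Q f (v) = ψ(f(v))` if `f ≡ c (mod 𝔪_v)`,
`deg v = 1`, `v ≠ Q`. [cite: KohelShparlinski2000, §1 (definition of S(ω,ψ,f))] -/
theorem traceResidueChar_single_one_eq (ψ : AddChar K M) {Q v : PlaceOver K F} (hv : v ≠ Q)
    (hv1 : v.IsRational) {f : F} (hf : f ∈ v.toValuationSubring) {c : K}
    (hc : v.valuation (f - algebraMap K F c) < 1) :
    traceResidueChar ψ Q f (Finsupp.single v 1) = ψ c := by
  rw [traceResidueChar_single, Int.cast_one, one_mul, traceResidue_eq_of_sub_algebraMap_mem hv hv1 hf hc]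

/-- **`ψ ∘ f` is a ray class character modulo `(m+1)·Q`**: it kills the divisor of every ray function
`h ≡ 1 (mod 𝔪_Q^{m+1})` when `f` is regular outside `Q` with `v_Q(f) ≥ -m`.
[cite: KohelShparlinski2000, Thm. 1] -/
theorem traceResidueChar_principalDivisor_of_mem_ray [IsIntegrallyClosedIn K F] (ψ : AddChar K M)
    (Q : PlaceOver K F) {f : F} (hf : ∀ v : PlaceOver K F, v ≠ Q → f ∈ v.toValuationSubring)
    {m : ℕ} (hfm : f ∈ Q.ball (-(m : ℤ))) {h : F} (hray : h ∈ Q.ray (m + 1)) (hh : h ≠ 0) :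
    traceResidueChar ψ Q f (principalDivisor K h) = 1 := by
  rw [traceResidueChar_apply, traceDivisorHom_principalDivisor_eq_zero_of_mem_ray Q hf hfm hray hh,
    AddChar.map_zero_eq_one]

end Char

/-! ### Nontriviality: the test functions `1 + c s^m` -/

/-- **The residue of `f h⁻¹ dh` for `h = 1 + c s^m`.** Let `Q` be rational, `v_Q(f) = -m` (`m ≥ 1`),
`v_Q(s) = 1`, `c ∈ K`, `h = 1 + c s^m`. Then `h` is a unit at `Q` and
`res_Q(f h⁻¹ dh) = m c · Tr_{F_Q/K}((f s^m h⁻¹) mod Q)`, where `f s^m h⁻¹` is a unit at `Q`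
(Leibniz `d(s^m) = m s^{m-1} ds` and Tate's (R4) `res_Q(a s⁻¹ ds) = v_Q(s) Tr(ā)`).
[cite: Tate1968, §2 (R4) and Thm. 1] -/
theorem localRes_test_function {Q : PlaceOver K F} {f s : F} {m : ℕ} (hm : 1 ≤ m)
    (hf0 : f ≠ 0) (hf : Q.ord f = -(m : ℤ)) (hs0 : s ≠ 0) (hs : Q.ord s = 1) (c : K) :
    ∃ (hunit : f * s ^ m * (1 + c • s ^ m)⁻¹ ∈ Q.toValuationSubring),
      1 + c • s ^ m ≠ 0 ∧ Q.ord (1 + c • s ^ m) = 0 ∧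
      Q.localRes K (f * (1 + c • s ^ m)⁻¹) (1 + c • s ^ m) =
        (m : K) * c * Algebra.trace K Q.residueField
          (IsLocalRing.residue Q.toValuationSubring ⟨f * s ^ m * (1 + c • s ^ m)⁻¹, hunit⟩) := by
  set h : F := 1 + c • s ^ m with hh
  -- `h` is a unit at `Q`: `h ∈ ray m`
  have hsm : Q.ord (s ^ m) = m := by rw [Q.ord_pow hs0, hs, mul_one]
  have hcsm : c • s ^ m ∈ Q.ball (m : ℤ) := by
    rcases eq_or_ne c 0 with rfl | hc
    · rw [zero_smul]; exact zero_mem _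
    · rw [Q.mem_ball_iff_le_ord _ (smul_ne_zero hc (pow_ne_zero m hs0)), Algebra.smul_def,
        Q.ord_mul_eq ((_root_.map_ne_zero _).2 hc) (pow_ne_zero m hs0), ord_algebraMap_holds Q hc, hsm,
        zero_add]
  have hray : h ∈ Q.ray m := by
    rw [Q.mem_ray_iff_sub_one_mem_ball, hh, add_sub_cancel_left]; exact hcsm
  have hval : Q.valuation h = 1 := valuation_eq_one_of_mem_ray hm hray
  have hh0 : h ≠ 0 := by intro e; rw [e, Valuation.map_zero] at hval; exact zero_ne_one hval
  have hordh : Q.ord h = 0 := by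
    have := (Q.valuation_eq_zpow_iff_ord_eq hh0 0).1 (by rw [zpow_zero]; exact hval)
    exact this
  -- `a := f s^m h⁻¹` is a unit at `Q`
  have hfsm0 : f * s ^ m ≠ 0 := mul_ne_zero hf0 (pow_ne_zero m hs0)
  have hordfsm : Q.ord (f * s ^ m) = 0 := by rw [Q.ord_mul_eq hf0 (pow_ne_zero m hs0), hf, hsm]; ring
  have horda : Q.ord (f * s ^ m * h⁻¹) = 0 := by
    rw [Q.ord_mul_eq hfsm0 (inv_ne_zero hh0), Q.ord_inv hh0, hordfsm, hordh]; ring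
  have haO : f * s ^ m * h⁻¹ ∈ Q.toValuationSubring :=
    (Q.mem_toValuationSubring_iff_ord_nonneg (mul_ne_zero hfsm0 (inv_ne_zero hh0))).2 horda.ge
  refine ⟨haO, hh0, hordh, ?_⟩
  -- `res(f h⁻¹ dh) = res(f h⁻¹ d(c s^m)) = c · m · res(f h⁻¹ s^{m-1} ds)`
  have hstep1 : Q.localRes K (f * h⁻¹) h = c * Q.localRes K (f * h⁻¹) (s ^ m) := by
    conv_lhs => rw [hh]
    rw [Q.localRes_add_right, Q.localRes_one_right, zero_add, Q.localRes_smul_right]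
  have hstep2 : Q.localRes K (f * h⁻¹) (s ^ m) = (m : K) * Q.localRes K (f * h⁻¹ * s ^ ((m : ℤ) - 1)) s := by
    have := Q.localRes_zpow_right (f * h⁻¹) hs0 (m : ℤ)
    rw [zpow_natCast] at this
    rw [this]
    norm_cast
  -- `f h⁻¹ s^{m-1} = a s⁻¹` with `a = f s^m h⁻¹`
  have hstep3 : f * h⁻¹ * s ^ ((m : ℤ) - 1) = f * s ^ m * h⁻¹ * s⁻¹ := by
    rw [zpow_sub_one₀ hs0, zpow_natCast]; ring
  rw [hstep1, hstep2, hstep3, Q.localRes_mul_inv_eq_ord_mul_trace haO hs0, hs]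
  push_cast
  ring

/-- **The trace at a rational place detects units**: for `deg Q = 1` and `a ∈ 𝒪_Q` a unit,
`Tr_{F_Q/K}(a mod Q) ≠ 0` (it is the value `a(Q) ≠ 0`). [folklore] -/
theorem trace_residue_ne_zero_of_isRational {Q : PlaceOver K F} (hQ : Q.IsRational) {a : F}
    (haO : a ∈ Q.toValuationSubring) (ha : Q.valuation a = 1) :
    Algebra.trace K Q.residueField (IsLocalRing.residue Q.toValuationSubring ⟨a, haO⟩) ≠ 0 := by
  obtain ⟨c, hc⟩ := hQ.algebraMap_residueField_surjective (IsLocalRing.residue _ ⟨a, haO⟩)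
  rw [← hc, Algebra.trace_algebraMap]
  rw [PlaceOver.IsRational, PlaceOver.degree] at hQ
  rw [hQ, one_smul]
  intro hc0
  rw [hc0, map_zero, eq_comm, IsLocalRing.residue_eq_zero_iff, ValuationSubring.valuation_lt_one_iff] at hc
  exact (lt_irrefl _) (ha ▸ hc : Q.valuation a < Q.valuation a) |>.elim

/-- **Nontriviality of the trace-of-residues homomorphism on principal divisors prime to `Q`**
([KohelShparlinski2000, Thm. 1]: `m_i = n_i + 1` when `(n_i, q) = 1`, i.e. the conductor of `ψ ∘ f`
at a pole of order prime to `p` is exact). Let `Q` be rational, `f` regular outside `Q` with a pole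
of exact order `m ≥ 1` at `Q`, `s` a uniformizer at `Q`, and `m ≠ 0` in `K`. Then every `a ∈ K` is
`Σ_v v(h) Tr(f mod v)` for some `h ≠ 0` which is a unit at `Q` (namely `h = 1 + c s^m`).
[cite: KohelShparlinski2000, Thm. 1] [cite: Tate1968, §2 (R4)] -/
theorem exists_traceDivisorHom_principalDivisor_eq [IsIntegrallyClosedIn K F] {Q : PlaceOver K F}
    (hQ : Q.IsRational) {f s : F} (hf : ∀ v : PlaceOver K F, v ≠ Q → f ∈ v.toValuationSubring)
    {m : ℕ} (hm : 1 ≤ m) (hmK : (m : K) ≠ 0) (hf0 : f ≠ 0) (hfQ : Q.ord f = -(m : ℤ)) (hs0 : s ≠ 0)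
    (hs : Q.ord s = 1) (a : K) :
    ∃ h : F, h ≠ 0 ∧ Q.ord h = 0 ∧ traceDivisorHom Q f (principalDivisor K h) = a := by
  -- the unit `f s^m` at `Q` and its (nonzero) trace
  obtain ⟨h1O, -, -, -⟩ := localRes_test_function (K := K) hm hf0 hfQ hs0 hs (0 : K)
  have hκ0 : f * s ^ m * (1 + (0 : K) • s ^ m)⁻¹ = f * s ^ m := by rw [zero_smul, add_zero, inv_one, mul_one]
  set κ : K := Algebra.trace K Q.residueField
    (IsLocalRing.residue Q.toValuationSubring ⟨f * s ^ m * (1 + (0 : K) • s ^ m)⁻¹, h1O⟩) with hκ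
  have hκne : κ ≠ 0 := by
    refine trace_residue_ne_zero_of_isRational hQ h1O ?_
    have hfsm0 : f * s ^ m ≠ 0 := mul_ne_zero hf0 (pow_ne_zero m hs0)
    have hord0 : Q.ord (f * s ^ m * (1 + (0 : K) • s ^ m)⁻¹) = 0 := by
      rw [hκ0, Q.ord_mul_eq hf0 (pow_ne_zero m hs0), hfQ, Q.ord_pow hs0, hs]; ring
    have := (Q.valuation_eq_zpow_iff_ord_eq (by rw [hκ0]; exact hfsm0) 0).2 hord0
    rwa [zpow_zero] at this
  -- choose `c` with `-(m c κ') = a`, where `κ'` is the trace for this `c`; but `κ'` depends on `c`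
  -- only through the unit `h⁻¹ ≡ 1`: the traces agree
  set c : K := -a / ((m : K) * κ) with hc
  obtain ⟨hcO, hh0, hordh, hres⟩ := localRes_test_function (K := K) hm hf0 hfQ hs0 hs c
  refine ⟨1 + c • s ^ m, hh0, hordh, ?_⟩
  rw [traceDivisorHom_principalDivisor Q hf hh0, hres]
  -- the two residues `f s^m h⁻¹` and `f s^m` agree modulo `𝔪_Q`
  have htr : Algebra.trace K Q.residueField
      (IsLocalRing.residue Q.toValuationSubring ⟨f * s ^ m * (1 + c • s ^ m)⁻¹, hcO⟩) = κ := by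
    rw [hκ]
    congr 1
    rw [← sub_eq_zero, ← map_sub, IsLocalRing.residue_eq_zero_iff, ValuationSubring.valuation_lt_one_iff]
    -- `f s^m h⁻¹ - f s^m = f s^m h⁻¹ (1 - h) = -(f s^m h⁻¹) (c s^m)` has positive order
    have hval : Q.valuation (1 + c • s ^ m) = 1 := by
      have := (Q.valuation_eq_zpow_iff_ord_eq hh0 0).2 hordh
      rwa [zpow_zero] at this
    have hcsm : Q.valuation (c • s ^ m) < 1 := by
      rcases eq_or_ne c 0 with h0 | h0
      · rw [h0, zero_smul, Valuation.map_zero]; exact zero_lt_one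
      · have hne : c • s ^ m ≠ 0 := smul_ne_zero h0 (pow_ne_zero m hs0)
        rw [Q.valuation_lt_one_iff_ord_pos hne, Algebra.smul_def,
          Q.ord_mul_eq ((_root_.map_ne_zero _).2 h0) (pow_ne_zero m hs0), ord_algebraMap_holds Q h0,
          Q.ord_pow hs0, hs]
        simp only [zero_add, mul_one]; exact_mod_cast hm
    have haval : Q.valuation (f * s ^ m * (1 + c • s ^ m)⁻¹) ≤ 1 :=
      (Q.toValuationSubring.valuation_le_one_iff _).2 hcO
    change Q.valuation (f * s ^ m * (1 + c • s ^ m)⁻¹ - f * s ^ m * (1 + (0 : K) • s ^ m)⁻¹) < 1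
    have hid : f * s ^ m * (1 + c • s ^ m)⁻¹ - f * s ^ m * (1 + (0 : K) • s ^ m)⁻¹ =
        -(f * s ^ m * (1 + c • s ^ m)⁻¹ * (c • s ^ m)) := by
      rw [zero_smul, add_zero, inv_one, mul_one]
      field_simp
      ring
    rw [hid, Valuation.map_neg, Valuation.map_mul, mul_comm]
    exact mul_lt_one_of_lt_of_le hcsm haval
  rw [htr, hc]
  field_simp

/-- **`ψ ∘ f` is nontrivial on a principal divisor prime to `Q`** whenever `ψ ≠ 1`, under the
hypotheses of `exists_traceDivisorHom_principalDivisor_eq` (rational `Q`, exact pole order `m` prime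
to `p`). Together with `traceResidueChar_principalDivisor_of_mem_ray` (`ψ ∘ f` is trivial on the ray
modulo `(m+1)·Q`) this says that the conductor of `ψ ∘ f` at `Q` is exactly `(m+1)·Q`.
[cite: KohelShparlinski2000, Thm. 1] -/
theorem exists_traceResidueChar_principalDivisor_ne_one [IsIntegrallyClosedIn K F] {M : Type*}
    [CommMonoid M] {ψ : AddChar K M} (hψ : ψ ≠ 1) {Q : PlaceOver K F} (hQ : Q.IsRational) {f s : F}
    (hf : ∀ v : PlaceOver K F, v ≠ Q → f ∈ v.toValuationSubring) {m : ℕ} (hm : 1 ≤ m)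
    (hmK : (m : K) ≠ 0) (hf0 : f ≠ 0) (hfQ : Q.ord f = -(m : ℤ)) (hs0 : s ≠ 0) (hs : Q.ord s = 1) :
    ∃ h : F, h ≠ 0 ∧ Q.ord h = 0 ∧ traceResidueChar ψ Q f (principalDivisor K h) ≠ 1 := by
  obtain ⟨a, ha⟩ : ∃ a : K, ψ a ≠ 1 := by
    by_contra hall
    push Not at hall
    exact hψ (by ext a; exact hall a)
  obtain ⟨h, hh0, hordh, hval⟩ := exists_traceDivisorHom_principalDivisor_eq hQ hf hm hmK hf0 hfQ hs0 hs a
  exact ⟨h, hh0, hordh, by rwa [traceResidueChar_apply, hval]⟩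

end PlaceOver

end Literature.NumberTheory.DiophantineGeometry.AlgFunctionField
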